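/-
Fleet lead `ym-wcr-19609-p1` (seat prover-ym-wcr-19609-p1-g2-0), route `WeakCouplingRates`, crux `BulkDominatesColdBoxW`
(stmt-QuantumFields-19609), line `dlr-chessboard` (v5): SU(2) instantiation of brick M2 and the single-plaquette energy bound.
-/
import Summits.QuantumFields.YangMills.Theorems.WeakCouplingRatesBulkDominatesColdBoxWForestPoincareDatum
import Summits.QuantumFields.YangMills.Theorems.WeakCouplingRatesBulkDominatesColdBoxWDatumBackground
import Summits.QuantumFields.YangMills.Theorems.WeakCouplingRatesBulkDominatesColdBoxWCrudeGoodGauge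

/-!
# Crux `BulkDominatesColdBoxW`, interfaces `KernelMeanExpansion` / `KernelCovExpansion`: SMALL LINKS in the temporal-forest gauge with a small
# `SU(2)` exterior datum, and the single-plaquette bound of the background from its energy

Two small inputs of the one-scale assembly with a datum (census v3, item evidence #12, brick table §4):

* `su2_opDist1_le_uniform_of_exterior_le` — the `SU(2)` instantiation of M2 `ell_le_uniform_of_exterior_le` with the length
  `ℓ = opDist1 ∘ fundamentalRep (Fin 2)` (`‖ρ(U) − 1‖_op`: `ℓ 1 = 0`, subadditive, inversion and conjugation invariant — tree
  `UnitaryModel.opDist1_map_mul_le / _map_inv / _map_conj`): if the exterior links of `V : ℤ⁴ → SU(2)` are within `r` of `1`, the forest links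
  are `1`, and every plaquette has cost `2 − Re tr ≤ c`, then EVERY link satisfies `‖ρ(V_e) − 1‖_op ≤ (12H²+2H+1)(√(2c) + 4r)` (`H ≥ 1`) — the
  sup-norm smallness `m` feeding the cubic chart remainder on the good event, uniformly over crude-good data (`r = r₀` of
  `exists_gauge_opDist1_le_of_crudeGood`, `c = β^{2ε−1}` of `boxKernel_largeField_rarity_crudeGood`);
* `dirBackground_sq_le_formM` — for every plaquette label `p` of the enlarged box, `F̄_{a+p}² ≤ M_θ(s)` for every competitor `s` (one term of the
  energy `Σ_p F̄² = K_θ ≤ M_θ(s)`, `sum_dirBackground_sq_le_formM`): the crude pointwise bound used for the Gaussian good-event inclusion near the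
  boundary layer (`√β|F̄_p| ≤ (βE)^{1/2}`).

No new definition; standard axioms.  NOT a claim about the mass gap.
-/

set_option autoImplicit false

noncomputable section

open Finset
open scoped Matrix.Norms.L2Operator
open Literature.Probability.LatticeModels Literature.MathematicalPhysics Literature.MathematicalPhysics.QuantumLattice
open Literature.MathematicalPhysics.QuantumFieldTheory Literature.MathematicalPhysics.QuantumFieldTheory.AxialGauge
open Literature.MathematicalPhysics.QuantumFieldTheory.LatticeMaxwell
open Literature.MathematicalPhysics.QuantumFieldTheory.Balaban1983to89 Literature.MathematicalPhysics.QuantumFieldTheory.Balaban1983to89.UnitaryModel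

namespace Summit.QuantumFields.YangMills.Theorems.WeakCouplingRates

/-! ## Small links with a small `SU(2)` exterior datum -/

/-- **Small links in the forest gauge with a small exterior, `SU(2)`.**  Let `V : ℤ⁴ → SU(2)` have exterior links (off the cold box
`boxEdges 4 (2H+1)`) within `r ≥ 0` of `1` in operator norm, forest links equal to `1`, and all plaquette costs `2 − Re tr ρ(V_p) ≤ c`.  Then every
link satisfies `‖ρ(V_e) − 1‖_op ≤ (12H² + 2H + 1)·(√(2c) + 4r)` (`H ≥ 1`). -/
theorem su2_opDist1_le_uniform_of_exterior_le {H : ℕ} (hH : 1 ≤ H) (V : LGConfig 4 (Matrix.specialUnitaryGroup (Fin 2) ℂ)) {r c : ℝ}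
    (hr : 0 ≤ r) (hout : ∀ e, e ∉ boxEdges 4 (2 * H + 1) → opDist1 (fundamentalRep (Fin 2) (V e)) ≤ r)
    (hforest : ∀ x : Site 4, (∀ k : Fin 4, 1 ≤ x k ∧ x k + 1 ≤ 2 * (H : ℤ)) → V (x, 0) = 1)
    (hc : ∀ (x : Site 4) (i j : Fin 4), 2 - (fundamentalRep (Fin 2) (plaquetteHolonomyZd V x i j)).trace.re ≤ c)
    (e : Literature.MathematicalPhysics.QuantumLattice.ZdEdge 4) :
    opDist1 (fundamentalRep (Fin 2) (V e)) ≤ (12 * (H : ℝ) ^ 2 + 2 * H + 1) * (Real.sqrt (2 * c) + 4 * r) := by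
  have hρu : ∀ g : Matrix.specialUnitaryGroup (Fin 2) ℂ, fundamentalRep (Fin 2) g ∈ Matrix.unitaryGroup (Fin 2) ℂ :=
    fundamentalRep_mem_unitaryGroup
  have hM : ∀ (x : Site 4) (i j : Fin 4), opDist1 (fundamentalRep (Fin 2) (plaquetteHolonomyZd V x i j)) ≤ Real.sqrt (2 * c) :=
    fun x i j => opDist1_le_sqrt_of_cost_le (hc x i j)
  exact ell_le_uniform_of_exterior_le (fun g => opDist1 (fundamentalRep (Fin 2) g))
    (by simp only [map_one]; exact UnitaryModel.opDist1_one)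
    (fun x y => opDist1_map_mul_le (fundamentalRep (Fin 2)) hρu x y)
    (fun x => opDist1_map_inv (fundamentalRep (Fin 2)) hρu x)
    (fun x g => opDist1_map_conj (fundamentalRep (Fin 2)) hρu g x)
    V hout hforest hM hH hr e

/-! ## One plaquette of the background is controlled by the energy -/

/-- **Single-plaquette bound from the energy**: for every plaquette label `p` of the enlarged box and every competitor `s`,
`F̄_{a+p}² ≤ M_θ(s)`, `F̄ = sCirc (glue θ μ_θ)` the background circulation of the datum `θ`. -/
theorem dirBackground_sq_le_formM (H : ℕ) (θ : Literature.MathematicalPhysics.QuantumLattice.ZdEdge 4 → ℝ) (s : DirFree H → ℝ)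
    {p : Plaq 4} (hp : p ∈ plaquettesIn (halfOpenBox 4 (2 * H + 3))) :
    sCirc (LatticeMaxwell.glue (pin := fun e => e ∉ dirFreeEdges H) dirCorner (2 * H + 3) θ
        (mean (fun e => e ∉ dirFreeEdges H) dirCorner (2 * H + 3) θ)) (Plaq.shift dirCorner p) ^ 2 ≤
      formM (fun e => e ∉ dirFreeEdges H) dirCorner (2 * H + 3) θ s := by
  refine le_trans ?_ (sum_dirBackground_sq_le_formM H θ s)
  exact Finset.single_le_sum (f := fun p' => sCirc (LatticeMaxwell.glue (pin := fun e => e ∉ dirFreeEdges H) dirCorner (2 * H + 3) θ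
    (mean (fun e => e ∉ dirFreeEdges H) dirCorner (2 * H + 3) θ)) (Plaq.shift dirCorner p') ^ 2) (fun p' _ => sq_nonneg _) hp

end Summit.QuantumFields.YangMills.Theorems.WeakCouplingRates

end
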